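import Summits.QuantumFields.YangMills.Theorems.BalabanUVNodesN21GappedTopPairReading13CoPHCmapSignFree

/-!
# K3ᴬ v8 STUB 2 AT THE ZERO CUT READING — THE LEDGER BY NAME: the core socket at the doubly-gapped χ-reading (a witness on the NAMED cores `gapCore2A∕B₁₃Chi` gives the v8
# conjunct's core), the EMPTY bad class folded in, the minted split reading carrying ALL SIX conjuncts, and the final bill «`DialRows` + NE7's core with EMPTY bad class on the
# re-centred doubly-gapped cores (live line) + node U5's target (off the line) ⟹ `stub_expansion13HV`'s text»

Cell `pub-ymgap` (HUMAN RULING D-0062, Track A), seat `pub-ymgap-dag-n20-d` (gen 46; R134 (a) N20 s3; op-5c-class K3ᴬ supply, `--kind proof --supports stmt-QuantumFields-27247 --as helper`;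
count-neutral; proves NO registered stub).  The capstone of this lineage's g46 files at the K3ᴬ v8 pin (✓p811026 · ✓p812358 · ✓p813406 · ✓p813745 · ✓p813854): §1 is the χ-twin
of dag-n21-d's core socket (`…GappedPairRoadK3V6KnitOfCloseness.keyedCoreEdgeHolderD4V_of_gap2Pin_of_witness_signFree`, proof body: dag-n15-a's `gapWeight2A∕B₁₃Chi_sub_gapShell2A∕B₁₃`
by `funext`) — CROSS-LANE, declared; no n19 ∕ n21 ∕ n27 seat on the bus since 2026-08-31T00:32Z.
[LF-II] = [Balaban1989LargeFieldII], [LF-I] = [Balaban1989LargeFieldI].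

CONTENTS.  §1 `core_crGap2₁₃VAtCmap_of_witness` (any `Χ K₀ jcut ρ ρ′ n₁ n₂`, any tuple: `NE7.Core` on the NAMED carriers `classSet₁₃Chi ∕ badClass₁₃Chi … jcut ∕ gapCore2A∕B₁₃Chi` ⟹
`NE7.Core` on the reading's fields `(A − shA, B − shB)` — `rfl` dictionary + `funext`) · `badClass₁₃Chi_cutZero_fun` (the zero policy's bad class IS `fun _ _ ↦ ∅`, ✓p811026) ·
★ `core_crGap2₁₃VAtCmap_cutZero_of_witness_emptyBad` (at the zero cut the witness may be stated with the EMPTY bad class: NE7 proper on ALL classes).  §2 AT THE MIRROR (`N = 2`):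
★★★ `exists_gap2PinnedSplitReading_allFaces_cutZero` — from `DialRows ρ ρ′ n₁ n₂`, a core witness with EMPTY bad class on the re-centred doubly-gapped cores ON THE LIVE LINE (slot-keyed,
under (B) → END → `ForSmallCouplings (datumOfRecord₁₃SepCoPHVAx …)` → `PHolderD4 β`) and node U5's `Target` OFF it: ∃ cr, v8's pin at `jc ≡ 0` ∧ the off-live pin ∧ `KeyedRelWeight cr ∧
KeyedShellWeight cr ∧ KeyedExtractionV cr ∧ KeyedCoreEdgeHolderD4V β cr rr`.  §3 ★★★ THE FINAL BILL `stub2Text_of_dialRows_emptyBadCore_cutZero`: per `β` and guarded K4-faced reading,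
the three hypotheses of §2 ⟹ THE REGISTERED STUB-2 TEXT (`K3Skeleton13SepCoPHAxV8.stub_expansion13HV`'s type ∕ `K3AxV8StubTexts.Stub2TextV8`, byte for byte).
▶ THE LEDGER OF RECORD (located, count-neutral): K3ᴬ v8's stub 2 at the zero cut reading ⟸ [prover's dial] `DialRows ρ ρ′ n₁ n₂` ∧ [live line, per guarded admissible tuple, slot-keyed
prefix] `∃ δ, NE7.Core 1 (F.side⁴) (classSet₁₃Ax θ 0 g₀) (fun _ _ ↦ ∅) (gapCore2A₁₃Chi θ (chiβOfRecord₁₃Ax …) h.toCore 0 g₀ os ρ… ρ′… n₁… n₂…) (gapCore2B₁₃Chi …) δ ∧ Summable δ` = NE7 PROPER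
ON ALL KEYED CLASSES of the re-centred record (NOT PRINTED for `d = 4`) ∧ [off the line] `∃ δ, NE7.Target (F.side⁴) 1 δ (K ↦ Z_K)` at `datumOfRecord₁₃CoPHAx` (NOT PRINTED).  The pin,
N20, N21, N27x are PAID BY NAME.

HONEST FRAMING.  [folklore] `rfl` ∕ `funext` ∕ case-split bookkeeping BY NAME; NO estimate of Bałaban's; the core and the target are the OTHER lanes' content (N19′ ∕ node U5), NOT PRINTED
for `d = 4`, HYPOTHESES asserted for no family; NO stub of K3ᴬ v8 is closed or claimed (0∕2); no `Provisos₁₃CoPHChi ∕ …Ax` inhabitant claimed (K0ᴬ OPEN); N19 ∕ N20 ∕ N21 ∕ N27 NOT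
discharged; counts UNMOVED (typed 28∕28 · discharged 8∕27 · A 8∕28 · K 1∕4).  One finite `𝕋⁴_{L^K}` programme at fixed `ε = L^{−K}`, Bałaban AS PRINTED — NOT ℝ⁴, NOT infinite volume,
NOT OS, NOT a mass gap; the YM mass gap (Clay) is NOT proved by any of this.  No `def`, no `instance`, no `notation`, no `sorry`, standard axioms.
Sources (locators, bookkeeping only): [LF-II] Thm 1 + (0.1) pp.355–356, (1.80) p.384; [LF-I] (0.2)–(0.4) p.176, p.181; [King1986] (3.10)–(3.11) p.656.
-/

set_option autoImplicit false

noncomputable section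

open scoped BigOperators
open Finset MeasureTheory

namespace Summit.QuantumFields.YangMills.BalabanUVNodes.N20K3AxV8Stub2LedgerCutZero

open Literature.MathematicalPhysics.QuantumFieldTheory.Balaban1983to89
open Literature.MathematicalPhysics.QuantumFieldTheory.Balaban1983to89.T4Continuum
open Literature.MathematicalPhysics.QuantumFieldTheory.Balaban1983to89.Node00
open Literature.MathematicalPhysics.QuantumFieldTheory.Balaban1983to89.T4ContinuumYM4Torus (ForSmallCouplings)
open Summit.QuantumFields.BalabanUV.T4Continuum.Spine
open T4IndicatorShell (ShellWeightBound)
open T4WeightBudget (RelWeightBound)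
open YMDAG.UVSplit (runA₁₃ runB₁₃ keyA₁₃Chi keyB₁₃Chi histA₁₃Chi histB₁₃Chi classSet₁₃Chi badClass₁₃Chi SpineReading₁₃CoPHCmap SpineReading₁₃CoPHAx classSet₁₃Ax badClass₁₃Ax)
open Summit.QuantumFields.YangMills.Theorems.N21ShellSplitOfRecord13CoPH (WidthLetter₁₃CoPHCmap DepthLetter₁₃CoPHCmap WidthLetter₁₃CoPHAx DepthLetter₁₃CoPHAx)
open Summit.QuantumFields.YangMills.Theorems.N21GappedTopPair13CoPH (gapWeight2A₁₃Chi gapWeight2B₁₃Chi gapShell2A₁₃Chi gapShell2B₁₃Chi gapCore2A₁₃Chi gapCore2B₁₃Chi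
  gapWeight2A₁₃Chi_sub_gapShell2A₁₃ gapWeight2B₁₃Chi_sub_gapShell2B₁₃ crGap2₁₃VAtCmap crGap2₁₃VAx keyedShell_extraction_of_liveGap2Pin)
open Summit.QuantumFields.YangMills.Theorems.K3AxV8Defs
open Summit.QuantumFields.YangMills.BalabanUVNodes.N20KeyedRelWeightAtGap2ReadingCmap (badClass₁₃Chi_cutZero)
open Summit.QuantumFields.YangMills.BalabanUVNodes.N20OffLiveOneTermReadingCmap (crOneTerm₁₃Ax exists_reading_livePin keyedRelWeight_of_liveGap2Pin_cutZero
  keyedCoreEdgeHolderD4V_of_livePin)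

variable {F : T4Family} {N : ℕ} [NeZero N]

/-! ## §1 The core socket at the doubly-gapped χ-reading; the empty bad class folded in -/

section Socket

variable (Χ : (F : T4Family) → Stage13Params F N → ChiSlot F N) (K₀ : ℕ) (jcut : ℕ → ℕ) (ρ ρ' : WidthLetter₁₃CoPHCmap N Χ) (n₁ n₂ : DepthLetter₁₃CoPHCmap N Χ)
  (θ : Stage13HParams F N) (hP : θ.Provisos₁₃CoPHChi F N (Χ F θ.toStage13Params)) (g₀ : ℕ → ℝ) (os : List (ULoop F))

/-- **THE CORE SOCKET AT THE DOUBLY-GAPPED χ-READING**: an `NE7.Core` witness `δ` on the NAMED carriers — χ-class set, χ-bad class of `jcut`, doubly-gapped χ-CORES `gapCore2A∕B₁₃Chi` — IS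
the v8 core statement on the reading's own fields `(A − shA, B − shB)` (dag-n15-a's `rfl` dictionary + `gapWeight2A∕B₁₃Chi_sub_gapShell2A∕B₁₃` by `funext`).  χ-twin of dag-n21-d's
socket; both sides HYPOTHESES (NE7 NOT PRINTED for `d = 4`). [cite: Balaban1989LargeFieldII, Thm 1 + (0.1) pp.355–356; Balaban1989LargeFieldI, (0.2)–(0.4) p.176 (bookkeeping)] -/
theorem core_crGap2₁₃VAtCmap_of_witness {δ : ℕ → ℝ}
    (hδ : letI : DecidableEq (Σ K, SiteSeqKey F (K₀ + K)) := Classical.decEq _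
      NE7.Core 1 ((F.side : ℝ) ^ 4) (classSet₁₃Chi θ (Χ F θ.toStage13Params) K₀ g₀) (badClass₁₃Chi θ (Χ F θ.toStage13Params) K₀ g₀ jcut)
        (gapCore2A₁₃Chi θ (Χ F θ.toStage13Params) hP K₀ g₀ os (ρ F θ hP g₀ os) (ρ' F θ hP g₀ os) (n₁ F θ hP g₀ os) (n₂ F θ hP g₀ os))
        (gapCore2B₁₃Chi θ (Χ F θ.toStage13Params) hP K₀ g₀ os (ρ F θ hP g₀ os) (ρ' F θ hP g₀ os) (n₁ F θ hP g₀ os) (n₂ F θ hP g₀ os)) δ) :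
    letI := (crGap2₁₃VAtCmap Χ K₀ jcut ρ ρ' n₁ n₂ F θ hP g₀ os).dec
    NE7.Core (crGap2₁₃VAtCmap Χ K₀ jcut ρ ρ' n₁ n₂ F θ hP g₀ os).l₀ (crGap2₁₃VAtCmap Χ K₀ jcut ρ ρ' n₁ n₂ F θ hP g₀ os).vol (crGap2₁₃VAtCmap Χ K₀ jcut ρ ρ' n₁ n₂ F θ hP g₀ os).T
      (crGap2₁₃VAtCmap Χ K₀ jcut ρ ρ' n₁ n₂ F θ hP g₀ os).Bad
      (fun K t τ => (crGap2₁₃VAtCmap Χ K₀ jcut ρ ρ' n₁ n₂ F θ hP g₀ os).A K t τ - (crGap2₁₃VAtCmap Χ K₀ jcut ρ ρ' n₁ n₂ F θ hP g₀ os).shA K t τ)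
      (fun K t τ => (crGap2₁₃VAtCmap Χ K₀ jcut ρ ρ' n₁ n₂ F θ hP g₀ os).B K t τ - (crGap2₁₃VAtCmap Χ K₀ jcut ρ ρ' n₁ n₂ F θ hP g₀ os).shB K t τ) δ := by
  have hA : (fun K t x => gapWeight2A₁₃Chi θ (Χ F θ.toStage13Params) hP K₀ g₀ os (ρ F θ hP g₀ os) (ρ' F θ hP g₀ os) (n₁ F θ hP g₀ os) (n₂ F θ hP g₀ os) K t x -
      gapShell2A₁₃Chi θ (Χ F θ.toStage13Params) hP K₀ g₀ os (ρ F θ hP g₀ os) (ρ' F θ hP g₀ os) (n₁ F θ hP g₀ os) (n₂ F θ hP g₀ os) K t x) =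
      gapCore2A₁₃Chi θ (Χ F θ.toStage13Params) hP K₀ g₀ os (ρ F θ hP g₀ os) (ρ' F θ hP g₀ os) (n₁ F θ hP g₀ os) (n₂ F θ hP g₀ os) :=
    funext fun K => funext fun t => funext fun x => gapWeight2A₁₃Chi_sub_gapShell2A₁₃ θ _ hP K₀ g₀ os _ _ _ _ K t x
  have hB : (fun K t x => gapWeight2B₁₃Chi θ (Χ F θ.toStage13Params) hP K₀ g₀ os (ρ F θ hP g₀ os) (ρ' F θ hP g₀ os) (n₁ F θ hP g₀ os) (n₂ F θ hP g₀ os) K t x -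
      gapShell2B₁₃Chi θ (Χ F θ.toStage13Params) hP K₀ g₀ os (ρ F θ hP g₀ os) (ρ' F θ hP g₀ os) (n₁ F θ hP g₀ os) (n₂ F θ hP g₀ os) K t x) =
      gapCore2B₁₃Chi θ (Χ F θ.toStage13Params) hP K₀ g₀ os (ρ F θ hP g₀ os) (ρ' F θ hP g₀ os) (n₁ F θ hP g₀ os) (n₂ F θ hP g₀ os) :=
    funext fun K => funext fun t => funext fun x => gapWeight2B₁₃Chi_sub_gapShell2B₁₃ θ _ hP K₀ g₀ os _ _ _ _ K t x
  letI : DecidableEq (Σ K, SiteSeqKey F (K₀ + K)) := Classical.decEq _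
  show NE7.Core 1 ((F.side : ℝ) ^ 4) (classSet₁₃Chi θ (Χ F θ.toStage13Params) K₀ g₀) (badClass₁₃Chi θ (Χ F θ.toStage13Params) K₀ g₀ jcut)
    (fun K t x => gapWeight2A₁₃Chi θ (Χ F θ.toStage13Params) hP K₀ g₀ os (ρ F θ hP g₀ os) (ρ' F θ hP g₀ os) (n₁ F θ hP g₀ os) (n₂ F θ hP g₀ os) K t x -
      gapShell2A₁₃Chi θ (Χ F θ.toStage13Params) hP K₀ g₀ os (ρ F θ hP g₀ os) (ρ' F θ hP g₀ os) (n₁ F θ hP g₀ os) (n₂ F θ hP g₀ os) K t x)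
    (fun K t x => gapWeight2B₁₃Chi θ (Χ F θ.toStage13Params) hP K₀ g₀ os (ρ F θ hP g₀ os) (ρ' F θ hP g₀ os) (n₁ F θ hP g₀ os) (n₂ F θ hP g₀ os) K t x -
      gapShell2B₁₃Chi θ (Χ F θ.toStage13Params) hP K₀ g₀ os (ρ F θ hP g₀ os) (ρ' F θ hP g₀ os) (n₁ F θ hP g₀ os) (n₂ F θ hP g₀ os) K t x) δ
  rw [hA, hB]
  exact hδ

/-- **THE χ-BAD CLASS OF THE ZERO POLICY, AS A FUNCTION, IS THE EMPTY FAMILY** (`funext` over ✓p811026 `badClass₁₃Chi_cutZero`). [cite: Balaban1989LargeFieldII, (1.80) p.384; King1986, (3.10) p.656 (bookkeeping)] -/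
theorem badClass₁₃Chi_cutZero_fun (χ : ChiSlot F N) :
    badClass₁₃Chi θ χ K₀ g₀ (fun _ => 0) = fun _ _ => (∅ : Finset (Σ K, SiteSeqKey F (K₀ + K))) :=
  funext fun K => funext fun t => badClass₁₃Chi_cutZero θ χ K₀ g₀ K t

/-- ★ **THE CORE SOCKET AT THE ZERO CUT WITH THE EMPTY BAD CLASS WRITTEN IN**: at `jcut ≡ 0` the supplier may state its `NE7.Core` witness with `Bad := fun _ _ ↦ ∅` — NE7 PROPER ON ALL
χ-CLASSES of the doubly-gapped cores — and it IS the v8 core statement at the reading (§1 + `badClass₁₃Chi_cutZero_fun`).  HYPOTHESIS-shaped; NE7 NOT PRINTED for `d = 4`.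
[cite: Balaban1989LargeFieldII, Thm 1 + (0.1) pp.355–356, (1.80) p.384; King1986, (3.10) p.656 (bookkeeping)] -/
theorem core_crGap2₁₃VAtCmap_cutZero_of_witness_emptyBad {δ : ℕ → ℝ}
    (hδ : letI : DecidableEq (Σ K, SiteSeqKey F (K₀ + K)) := Classical.decEq _
      NE7.Core 1 ((F.side : ℝ) ^ 4) (classSet₁₃Chi θ (Χ F θ.toStage13Params) K₀ g₀) (fun _ _ => (∅ : Finset (Σ K, SiteSeqKey F (K₀ + K))))
        (gapCore2A₁₃Chi θ (Χ F θ.toStage13Params) hP K₀ g₀ os (ρ F θ hP g₀ os) (ρ' F θ hP g₀ os) (n₁ F θ hP g₀ os) (n₂ F θ hP g₀ os))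
        (gapCore2B₁₃Chi θ (Χ F θ.toStage13Params) hP K₀ g₀ os (ρ F θ hP g₀ os) (ρ' F θ hP g₀ os) (n₁ F θ hP g₀ os) (n₂ F θ hP g₀ os)) δ) :
    letI := (crGap2₁₃VAtCmap Χ K₀ (fun _ => 0) ρ ρ' n₁ n₂ F θ hP g₀ os).dec
    NE7.Core (crGap2₁₃VAtCmap Χ K₀ (fun _ => 0) ρ ρ' n₁ n₂ F θ hP g₀ os).l₀ (crGap2₁₃VAtCmap Χ K₀ (fun _ => 0) ρ ρ' n₁ n₂ F θ hP g₀ os).vol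
      (crGap2₁₃VAtCmap Χ K₀ (fun _ => 0) ρ ρ' n₁ n₂ F θ hP g₀ os).T (crGap2₁₃VAtCmap Χ K₀ (fun _ => 0) ρ ρ' n₁ n₂ F θ hP g₀ os).Bad
      (fun K t τ => (crGap2₁₃VAtCmap Χ K₀ (fun _ => 0) ρ ρ' n₁ n₂ F θ hP g₀ os).A K t τ - (crGap2₁₃VAtCmap Χ K₀ (fun _ => 0) ρ ρ' n₁ n₂ F θ hP g₀ os).shA K t τ)
      (fun K t τ => (crGap2₁₃VAtCmap Χ K₀ (fun _ => 0) ρ ρ' n₁ n₂ F θ hP g₀ os).B K t τ - (crGap2₁₃VAtCmap Χ K₀ (fun _ => 0) ρ ρ' n₁ n₂ F θ hP g₀ os).shB K t τ) δ := by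
  refine core_crGap2₁₃VAtCmap_of_witness Χ K₀ (fun _ => 0) ρ ρ' n₁ n₂ θ hP g₀ os ?_
  rw [badClass₁₃Chi_cutZero_fun]
  exact hδ

end Socket

/-! ## §2 At the K3ᴬ v8 mirror (`N = 2`): the minted split reading at the zero cut carries ALL SIX conjuncts -/

section Mirror

variable (β : ℝ) (rr : RateReadingFn) (ρ ρ' : WidthLetter₁₃CoPHAx 2) (n₁ n₂ : DepthLetter₁₃CoPHAx 2)

/-- ★★★ **THE GAP-PINNED SPLIT READING AT THE ZERO CUT CARRIES v8's PIN AND ALL FOUR FACE CONJUNCTS** — from the dial rows `DialRows ρ ρ′ n₁ n₂`, an `NE7.Core` witness WITH THE EMPTY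
BAD CLASS on the re-centred doubly-gapped cores on the guarded admissible tuples OF THE LIVE LINE (slot-keyed: under (B) → END → `ForSmallCouplings (datumOfRecord₁₃SepCoPHVAx …)` →
`PHolderD4 β`; NE7 PROPER ON ALL KEYED CLASSES — NOT PRINTED for `d = 4`) and node U5's `Target` at the datum OFF the line (NOT PRINTED): ∃ cr, `PinnedAtLiveGap2 0 ρ ρ′ n₁ n₂ cr` ∧
off-live pin ∧ `KeyedRelWeight cr ∧ KeyedShellWeight cr ∧ KeyedExtractionV cr ∧ KeyedCoreEdgeHolderD4V β cr rr` (✓p813406 ∕ ✓p813854 ∕ ✓p813745 ∕ §1).  Both displayed hypotheses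
are the OTHER lanes' content, asserted for no family. [cite: Balaban1989LargeFieldII, Thm 1 + (0.1) pp.355–356, (1.80) p.384; King1986, (3.10)–(3.11) p.656 (bookkeeping)] -/
theorem exists_gap2PinnedSplitReading_allFaces_cutZero (hd : DialRows ρ ρ' n₁ n₂)
    (hcore : ∀ (F : T4Family) (θ : Stage13HParams F 2) (h : θ.Provisos₁₃SepCoPHAx F 2) (v : Revision₁₃Ax F 2 θ h),
      ((θ.ZhUnity F 2 ∧ θ.SlotsNondegenerate₁₃Ax F 2) ∧ LiveSel F θ) → θ.Admissible F 2 →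
      B16.EndStatementBPrinted (datumOfRecord₁₃SepCoPHVAx F 2 θ h v).C → DagBinding.EndpointExistence (datumOfRecord₁₃SepCoPHVAx F 2 θ h v).C.toB12 →
        ForSmallCouplings (datumOfRecord₁₃SepCoPHVAx F 2 θ h v) fun g₀ => ∀ os : List (ULoop F),
          PHolderD4 β (datumOfRecord₁₃SepCoPHVAx F 2 θ h v) (rr F θ h.toCore g₀ os) →
            letI : DecidableEq (Σ K, SiteSeqKey F (0 + K)) := Classical.decEq _
            ∃ δ : ℕ → ℝ, NE7.Core 1 ((F.side : ℝ) ^ 4) (classSet₁₃Ax θ 0 g₀) (fun _ _ => (∅ : Finset (Σ K, SiteSeqKey F (0 + K))))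
              (gapCore2A₁₃Chi θ (chiβOfRecord₁₃Ax F 2 θ.toStage13Params) h.toCore 0 g₀ os (ρ F θ h.toCore g₀ os) (ρ' F θ h.toCore g₀ os) (n₁ F θ h.toCore g₀ os)
                (n₂ F θ h.toCore g₀ os))
              (gapCore2B₁₃Chi θ (chiβOfRecord₁₃Ax F 2 θ.toStage13Params) h.toCore 0 g₀ os (ρ F θ h.toCore g₀ os) (ρ' F θ h.toCore g₀ os) (n₁ F θ h.toCore g₀ os)
                (n₂ F θ h.toCore g₀ os)) δ ∧ Summable δ)
    (htarget : ∀ (F : T4Family) (θ : Stage13HParams F 2) (hP : θ.Provisos₁₃CoPHAx F 2), ((θ.ZhUnity F 2 ∧ θ.SlotsNondegenerate₁₃Ax F 2) ∧ ¬ LiveSel F θ) →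
      θ.Admissible F 2 → ∀ (g₀ : ℕ → ℝ) (os : List (ULoop F)), PHolderD4 β (datumOfRecord₁₃CoPHAx F 2 θ hP) (rr F θ hP g₀ os) →
        ∃ δ : ℕ → ℝ, NE7.Target ((F.side : ℝ) ^ 4) 1 δ (fun K => T4GenFunBounds.schemeZ ((datumOfRecord₁₃CoPHAx F 2 θ hP).scheme g₀) os (0 + K))) :
    ∃ cr : SpineReading, PinnedAtLiveGap2 (fun _ _ _ _ _ => fun _ => 0) ρ ρ' n₁ n₂ cr ∧
      (∀ (F : T4Family) (θ : Stage13HParams F 2) (hP : θ.Provisos₁₃CoPHAx F 2) (g₀ : ℕ → ℝ) (os : List (ULoop F)),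
        ¬ LiveSel F θ → cr F θ hP g₀ os = crOneTerm₁₃Ax 0 F θ hP g₀ os) ∧
      KeyedRelWeight cr ∧ KeyedShellWeight cr ∧ KeyedExtractionV cr ∧ KeyedCoreEdgeHolderD4V β cr rr := by
  obtain ⟨cr, hon, hoff⟩ := exists_reading_livePin (crGap2₁₃VAx (N := 2) (fun _ => 0) ρ ρ' n₁ n₂)
  obtain ⟨h21, hx⟩ := keyedShell_extraction_of_liveGap2Pin (fun _ _ _ _ _ => fun _ => 0) ρ ρ' n₁ n₂ hon hoff hd
  refine ⟨cr, hon, hoff, keyedRelWeight_of_liveGap2Pin_cutZero ρ ρ' n₁ n₂ hoff hon, h21, hx, ?_⟩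
  refine keyedCoreEdgeHolderD4V_of_livePin hon hoff β rr (fun F θ h v hG hθ hB hE => ?_) htarget
  refine ForSmallCouplings.mono (fun g₀ h' os hPr => ?_) (hcore F θ h v hG hθ hB hE)
  obtain ⟨δ, hδ, hsum⟩ := h' os hPr
  exact ⟨δ, core_crGap2₁₃VAtCmap_cutZero_of_witness_emptyBad (fun F => chiβOfRecord₁₃Ax F 2) 0 ρ ρ' n₁ n₂ θ h.toCore g₀ os hδ, hsum⟩

end Mirror

/-! ## §3 The final bill at the zero cut reading -/

/-- **★★★ K3ᴬ v8's STUB 2 AT THE ZERO CUT READING FROM THE DIAL ROWS, NE7's CORE WITH THE EMPTY BAD CLASS ON THE LIVE LINE, AND NODE U5's TARGET OFF IT** — THE LEDGER OF RECORD: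
per `β ∈ ]2∕3, 1[` and guarded K4-faced reading `(𝔯, ksel, …)`, dials `ρ ρ′ n₁ n₂` with `DialRows ρ ρ′ n₁ n₂`, an `NE7.Core` witness with `Bad := ∅` on the re-centred doubly-gapped
cores `gapCore2A∕B₁₃Chi θ (chiβOfRecord₁₃Ax …) h.toCore 0 …` on the guarded admissible tuples of the live line (slot-keyed prefix, `PHolderD4 β` at `rrOfRecord 𝔯 ksel`; NE7 PROPER ON
ALL KEYED CLASSES — NOT PRINTED for `d = 4`), and node U5's `Target` off the line (NOT PRINTED) ⟹ THE REGISTERED STUB-2 TEXT, byte for byte.  The pin, N20, N21, N27x are PAID BY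
NAME; the two displayed hypotheses are the OTHER lanes' content, asserted for no family; NO stub is proved here. [cite: Balaban1989LargeFieldII, Thm 1 + (0.1) pp.355–356, (1.80) p.384; King1986, (3.10)–(3.11) p.656 (bookkeeping)] -/
theorem stub2Text_of_dialRows_emptyBadCore_cutZero
    (h : ∀ β : ℝ, 2 / 3 < β → β < 1 →
      ∀ (𝔯 : RateReading13AxP) (ksel : RunSel) (ℓ : LetterReading) (ℓ₃ : T4Family → Node00.NE3Letters₁₁) (g B : T4Family → ℝ),
        GuardedReadingN16 𝔯 ksel ℓ ℓ₃ g B → KeyedRatesHolderD4V β (rrOfRecord 𝔯 ksel) →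
        ∃ (ρ ρ' : WidthLetter₁₃CoPHAx 2) (n₁ n₂ : DepthLetter₁₃CoPHAx 2), DialRows ρ ρ' n₁ n₂ ∧
          (∀ (F : T4Family) (θ : Stage13HParams F 2) (h : θ.Provisos₁₃SepCoPHAx F 2) (v : Revision₁₃Ax F 2 θ h),
            ((θ.ZhUnity F 2 ∧ θ.SlotsNondegenerate₁₃Ax F 2) ∧ LiveSel F θ) → θ.Admissible F 2 →
            B16.EndStatementBPrinted (datumOfRecord₁₃SepCoPHVAx F 2 θ h v).C → DagBinding.EndpointExistence (datumOfRecord₁₃SepCoPHVAx F 2 θ h v).C.toB12 →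
              ForSmallCouplings (datumOfRecord₁₃SepCoPHVAx F 2 θ h v) fun g₀ => ∀ os : List (ULoop F),
                PHolderD4 β (datumOfRecord₁₃SepCoPHVAx F 2 θ h v) (rrOfRecord 𝔯 ksel F θ h.toCore g₀ os) →
                  letI : DecidableEq (Σ K, SiteSeqKey F (0 + K)) := Classical.decEq _
                  ∃ δ : ℕ → ℝ, NE7.Core 1 ((F.side : ℝ) ^ 4) (classSet₁₃Ax θ 0 g₀) (fun _ _ => (∅ : Finset (Σ K, SiteSeqKey F (0 + K))))
                    (gapCore2A₁₃Chi θ (chiβOfRecord₁₃Ax F 2 θ.toStage13Params) h.toCore 0 g₀ os (ρ F θ h.toCore g₀ os) (ρ' F θ h.toCore g₀ os) (n₁ F θ h.toCore g₀ os)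
                      (n₂ F θ h.toCore g₀ os))
                    (gapCore2B₁₃Chi θ (chiβOfRecord₁₃Ax F 2 θ.toStage13Params) h.toCore 0 g₀ os (ρ F θ h.toCore g₀ os) (ρ' F θ h.toCore g₀ os) (n₁ F θ h.toCore g₀ os)
                      (n₂ F θ h.toCore g₀ os)) δ ∧ Summable δ) ∧
          (∀ (F : T4Family) (θ : Stage13HParams F 2) (hP : θ.Provisos₁₃CoPHAx F 2), ((θ.ZhUnity F 2 ∧ θ.SlotsNondegenerate₁₃Ax F 2) ∧ ¬ LiveSel F θ) →
            θ.Admissible F 2 → ∀ (g₀ : ℕ → ℝ) (os : List (ULoop F)), PHolderD4 β (datumOfRecord₁₃CoPHAx F 2 θ hP) (rrOfRecord 𝔯 ksel F θ hP g₀ os) →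
              ∃ δ : ℕ → ℝ, NE7.Target ((F.side : ℝ) ^ 4) 1 δ (fun K => T4GenFunBounds.schemeZ ((datumOfRecord₁₃CoPHAx F 2 θ hP).scheme g₀) os (0 + K)))) :
    ∀ β : ℝ, 2 / 3 < β → β < 1 →
      ∀ (𝔯 : RateReading13AxP) (ksel : RunSel) (ℓ : LetterReading) (ℓ₃ : T4Family → Node00.NE3Letters₁₁) (g B : T4Family → ℝ),
        GuardedReadingN16 𝔯 ksel ℓ ℓ₃ g B → KeyedRatesHolderD4V β (rrOfRecord 𝔯 ksel) →
        ∃ (jc : CutReading) (ρ ρ' : WidthLetter₁₃CoPHAx 2) (n₁ n₂ : DepthLetter₁₃CoPHAx 2) (cr : SpineReading), PinnedAtLiveGap2 jc ρ ρ' n₁ n₂ cr ∧ DialRows ρ ρ' n₁ n₂ ∧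
          KeyedRelWeight cr ∧ KeyedShellWeight cr ∧ KeyedExtractionV cr ∧ KeyedCoreEdgeHolderD4V β cr (rrOfRecord 𝔯 ksel) := by
  intro β hβ hβ' 𝔯 ksel ℓ ℓ₃ g B hg hr
  obtain ⟨ρ, ρ', n₁, n₂, hd, hcore, htarget⟩ := h β hβ hβ' 𝔯 ksel ℓ ℓ₃ g B hg hr
  obtain ⟨cr, hon, -, h20, h21, hx, h19⟩ := exists_gap2PinnedSplitReading_allFaces_cutZero β (rrOfRecord 𝔯 ksel) ρ ρ' n₁ n₂ hd hcore htarget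
  exact ⟨fun _ _ _ _ _ => fun _ => 0, ρ, ρ', n₁, n₂, cr, hon, hd, h20, h21, hx, h19⟩

end Summit.QuantumFields.YangMills.BalabanUVNodes.N20K3AxV8Stub2LedgerCutZero

end
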